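import Summits.NavierStokesRegularity.NavierStokesRegularity.Theorems.RungReynoldsOne.Negative.WithoutLerayHopfFalse

/-!
# `DescentToRungOne` (stmt-NavierStokesRegularity-14842): the Leray–Hopf hypothesis is load-bearing

Negative (support) lemmas for the item `TypeICertificateLadder.DescentToRungOne` (for `C ≥ 1`, a
classical solution of unforced Navier–Stokes on `ℝ³ × [0, T)`, Leray–Hopf from a rapidly decaying
datum, with eventual rate `√(T − t)‖u(t, x)‖ ≤ C√ν`, which does NOT extend past `T`, eventually has
rate `≤ √ν`). The descent differs in shape from the exclusion rungs — its conclusion is a RATE BOUND,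
not an extension — so the load-bearing analysis of `Theorems/RungReynoldsOne/Negative/WithoutLerayHopfFalse.lean`
is redone for this shape with the same witness family, the parasitic Type-I drift
`u = g_C(t)·driftDir`, `p = −g_C′(t)x₀`, `g_C(t) = C((1 − t)^{-1/2} − 1)` of
Koch–Nadirashvili–Seregin–Šverák (Acta Math. 203 (2009), §1; arXiv:0709.3599 p. 3): it is classical
on `[0, 1) × ℝ³` from the datum `0`, Type-I(`C`) (`√(1 − t)‖u‖ = C(1 − √(1 − t)) ≤ C`), has no
classical extension past `1`, and its collapse Reynolds number tends to `C`; so for every level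
`C > 1` it NEVER descends to `1`. Hence with `IsLerayHopfOn` deleted every descent milestone above
level one is false, and so is the item's statement verbatim minus that clause: any proof of the
descent must use the energy class, exactly as for the rungs.
[cite: KochNadirashviliSereginSverak2009, §1 p. 3 (parasitic solutions)]
-/

noncomputable section

namespace Summit.NavierStokesRegularity.NavierStokesRegularity.Theorems.DescentToRungOneNegative

open Set Filter Topology
open Literature.Analysis.FluidPDE
open Summit.NavierStokesRegularity.NavierStokesRegularity.Theorems.RungReynoldsOneNegative

/-- The collapse Reynolds number of the Type-I drift tends to its level: `C(1 − √(1 − t)) → C` as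
`t ↑ 1`, so for `C > 1` it is eventually `> 1`. [folklore] -/
theorem eventually_one_lt_level_mul (C : ℝ) (hC : 1 < C) :
    ∀ᶠ t in 𝓝[<] (1 : ℝ), 1 < C * (1 - Real.sqrt (1 - t)) := by
  have hcont : Continuous fun t : ℝ => C * (1 - Real.sqrt (1 - t)) :=
    continuous_const.mul (continuous_const.sub (Real.continuous_sqrt.comp (continuous_const.sub continuous_id)))
  have hlim : Tendsto (fun t : ℝ => C * (1 - Real.sqrt (1 - t))) (𝓝[<] (1 : ℝ)) (𝓝 C) := by
    have h := (hcont.tendsto 1).mono_left (nhdsWithin_le_nhds (s := Iio (1 : ℝ)))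
    simpa using h
  exact hlim.eventually_const_lt hC

/-- **Load-bearing (finite energy), every level above one.** For every `C > 1` the descent
milestone at level `C` with the Leray–Hopf hypothesis dropped is FALSE: the Type-I drift
`u = g_C(t)driftDir`, `p = −g_C′(t)x₀` (`ν = T = 1`) is classical on `[0,1) × ℝ³` from the datum
`0`, has collapse Reynolds number `C(1 − √(1−t)) ≤ C` on `[0,1)`, no classical extension past `1`,
and its collapse Reynolds number tends to `C > 1`, so it is NOT eventually `≤ 1 = √ν`.
[cite: KochNadirashviliSereginSverak2009, §1 p. 3 (parasitic solutions)] -/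
theorem descentLevel_false_without_LerayHopf (C : ℝ) (hC : 1 < C) :
    ¬ (∀ (ν T : ℝ), 0 < ν → 0 < T → ∀ (u : ℝ → EuclideanSpace ℝ (Fin 3) → EuclideanSpace ℝ (Fin 3)) (p : ℝ → EuclideanSpace ℝ (Fin 3) → ℝ),
      IsClassicalNSSolutionOn (Set.Ico 0 T) ν 0 u p →
      HasRapidSpatialDecay (u 0) →
      (∀ᶠ t in 𝓝[<] T, ∀ x, Real.sqrt (T - t) * ‖u t x‖ ≤ C * Real.sqrt ν) →
      ¬ HasSmoothExtensionPast ν 0 u T →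
      ∀ᶠ t in 𝓝[<] T, ∀ x, Real.sqrt (T - t) * ‖u t x‖ ≤ Real.sqrt ν) := by
  intro h
  have hC0 : 0 < C := one_pos.trans hC
  have hev := h 1 1 one_pos one_pos (drift (gI C)) (driftP (gI C)) (drift_isClassical (gI_contDiffOn C) 1)
    (drift_rapidDecay (gI_zero C)) (driftI_rate C hC0.le)
    (drift_not_hasSmoothExtensionPast (tendsto_abs_gI_atTop C hC0) 1)
  obtain ⟨t, ht, hgt, ht01⟩ :=
    (hev.and ((eventually_one_lt_level_mul C hC).and (Ioo_mem_nhdsLT zero_lt_one))).exists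
  have hle : Real.sqrt (1 - t) * ‖drift (gI C) t (0 : EuclideanSpace ℝ (Fin 3))‖ ≤ 1 := by simpa using ht 0
  rw [norm_drift, abs_of_nonneg (gI_nonneg C hC0.le ht01.1.le ht01.2), sqrt_mul_gI C ht01.2] at hle
  exact absurd hle (not_le.2 hgt)

/-- **Load-bearing (finite energy), the item verbatim.** `DescentToRungOne` with the hypothesis
`IsLerayHopfOn T ν 0 (u 0) u` deleted is FALSE (the Type-I drift at level `C = 2`). So the energy
class is used by any proof of the item, and the item is not settled by junk: the remaining
hypotheses are jointly satisfiable by a non-extending Type-I solution whose collapse Reynolds number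
stays above `1`. [cite: KochNadirashviliSereginSverak2009, §1 p. 3 (parasitic solutions)] -/
theorem descentToRungOne_false_without_LerayHopf :
    ¬ (∀ C : ℝ, 1 ≤ C → ∀ (ν T : ℝ), 0 < ν → 0 < T → ∀ (u : ℝ → EuclideanSpace ℝ (Fin 3) → EuclideanSpace ℝ (Fin 3)) (p : ℝ → EuclideanSpace ℝ (Fin 3) → ℝ),
      IsClassicalNSSolutionOn (Set.Ico 0 T) ν 0 u p →
      HasRapidSpatialDecay (u 0) →
      (∀ᶠ t in 𝓝[<] T, ∀ x, Real.sqrt (T - t) * ‖u t x‖ ≤ C * Real.sqrt ν) →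
      ¬ HasSmoothExtensionPast ν 0 u T →
      ∀ᶠ t in 𝓝[<] T, ∀ x, Real.sqrt (T - t) * ‖u t x‖ ≤ Real.sqrt ν) :=
  fun h => descentLevel_false_without_LerayHopf 2 one_lt_two (h 2 one_le_two)

end Summit.NavierStokesRegularity.NavierStokesRegularity.Theorems.DescentToRungOneNegative

end
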